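import Summits.NavierStokesRegularity.NavierStokesRegularity.Theorems.AxisymmetricExtremalityAxisymmetricKatoGlobalStubSeregin2020TypeIILemma22PieceEnergy
import Summits.NavierStokesRegularity.NavierStokesRegularity.Theorems.AxisymmetricExtremalityAxisymmetricKatoGlobalStubSeregin2020TypeIILemma22CutExpansion
import Summits.NavierStokesRegularity.NavierStokesRegularity.Theorems.AxisymmetricExtremalityAxisymmetricKatoGlobalStubSeregin2020TypeIILemma22CutLimit
import Summits.NavierStokesRegularity.NavierStokesRegularity.Theorems.AxisymmetricExtremalityAxisymmetricKatoGlobalStubSeregin2020TypeIILemma22ExcisionBallCutoffs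
import HarnessLib

/-!
# L22-B, piece F3c (5/·): the telescoping-ready inequality of one time piece

Seregin 2020 Lemma 2.2 ⇐ N–U 2012 Lemma 4.2 for the class `𝒱` (cell ns-inputs, kit A1-L22B-F3, route P).
`pieceEnergy_summary` combines, on one closed time piece `[a,b]` of the excision schedule with active set
`A = {i ∈ s | tᵢ - 2rᵢ² ≤ a, b ≤ tᵢ + 2rᵢ²}` and excised test function `Ψ = Θ · ∏_{i∈A}(1-ψᵢ)`:
the per-piece inequality across `S` for the normalised pair (`pieceEnergy_real`, fed with es-p1's
`energyClass_ineq_acrossAxis_v3_real`), its expansion (`pieceEnergy_expanded`), and the two monotone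
comparisons `∫ φ²T ≤ ∫ T` for the gradient and `|η'|` terms (`integral_weight_le`).  Output: finiteness
of the cut dissipation and
`η(b)M_A(b) + D_A ≤ η(a)M_A(a) + (1+σ)·4∫T₁ + (1+σ⁻¹)·4·e₁ + ∫φ²T₂ + e₂ + ∫φ²T₃ + e₃ + ∫T₄`
(true integrands `T₁…T₄` of the `EnergyClass` text for `(Φ̃, Ũ)`, excision errors `e₁, e₂, e₃` in the
kit F3b.4 forms), ready for `telescope_pieces`. [cite: NazarovUraltseva2012, §3 (3.9), Remark 9]

Nothing here is a Navier–Stokes regularity statement.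
-/

noncomputable section

set_option linter.dupNamespace false

open MeasureTheory Set Function Filter Topology TopologicalSpace Metric
open scoped NNReal ENNReal InnerProductSpace RealInnerProductSpace

namespace Summit.NavierStokesRegularity.NavierStokesRegularity.Theorems.AxisymmetricKatoGlobal.EulerScaling

open Literature.Analysis.FluidPDE Literature.Analysis.FluidPDE.Seregin2020

/-- Reassociating a `φ²`-weight into a bounded factor: integrability of `η·(H·(φ²·g))` from that of
`η·(H·g)` for a continuous `φ` with values in `[0,1]`. [folklore] -/
theorem integrable_weight_mul {μ : Measure (ℝ × EuclideanSpace ℝ (Fin 3))} {η : ℝ → ℝ} {h g : ℝ × EuclideanSpace ℝ (Fin 3) → ℝ}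
    {φ : EuclideanSpace ℝ (Fin 3) → ℝ} (hφc : Continuous φ) (hφ0 : ∀ y, 0 ≤ φ y) (hφ1 : ∀ y, φ y ≤ 1)
    (hi : Integrable (fun w => η w.1 * (h w * g w)) μ) :
    Integrable (fun w => η w.1 * (h w * (φ w.2 ^ 2 * g w))) μ := by
  have e : (fun w : ℝ × EuclideanSpace ℝ (Fin 3) => η w.1 * (h w * (φ w.2 ^ 2 * g w))) =
      fun w => φ w.2 ^ 2 * (η w.1 * (h w * g w)) := by
    funext w; ring
  rw [e]
  refine hi.bdd_mul (c := 1) (((hφc.comp continuous_snd).pow 2).aestronglyMeasurable) ?_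
  refine Eventually.of_forall fun w => ?_
  rw [Real.norm_eq_abs, abs_of_nonneg (sq_nonneg _)]
  nlinarith [hφ0 w.2, hφ1 w.2]

/-- **The telescoping-ready inequality of one piece** (module docstring). -/
theorem pieceEnergy_summary
    -- class-𝒱 data
    {U : ℝ → EuclideanSpace ℝ (Fin 3) → EuclideanSpace ℝ (Fin 3)} {Φ : ℝ → EuclideanSpace ℝ (Fin 3) → ℝ}
    {S : Set (ℝ × EuclideanSpace ℝ (Fin 3))} {R k : ℝ}
    (hUc : ContinuousOn (uncurry U) {z : ℝ × EuclideanSpace ℝ (Fin 3) | z.1 < 0 ∧ cylRadius z.2 ≠ 0})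
    (hUs : ∀ z : ℝ × EuclideanSpace ℝ (Fin 3), z.1 < 0 → cylRadius z.2 ≠ 0 → ContDiffAt ℝ (⊤ : ℕ∞) (U z.1) z.2)
    (hdivU : ∀ z : ℝ × EuclideanSpace ℝ (Fin 3), z.1 < 0 → cylRadius z.2 ≠ 0 →
      VectorCalculus.divergence (U z.1) z.2 = 0)
    (hU3 : ∀ a : ℝ, 0 < a → ∫⁻ z in parabolicCylinder a (0 : ℝ × EuclideanSpace ℝ (Fin 3)), ‖U z.1 z.2‖ₑ ^ (3 : ℕ) < ∞)
    (hSc : IsClosed S) (hSax : ∀ z ∈ S, z.1 ≤ 0 ∧ cylRadius z.2 = 0)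
    (hΦc : ContinuousOn (uncurry Φ) ({z : ℝ × EuclideanSpace ℝ (Fin 3) | z.1 < 0} \ S))
    (hΦs : ∀ z : ℝ × EuclideanSpace ℝ (Fin 3), z.1 < 0 → z ∉ S → ContDiffAt ℝ (⊤ : ℕ∞) (Φ z.1) z.2)
    (hΦg : ContinuousOn (fun z : ℝ × EuclideanSpace ℝ (Fin 3) => fderiv ℝ (Φ z.1) z.2)
      ({z : ℝ × EuclideanSpace ℝ (Fin 3) | z.1 < 0} \ S))
    (hΦt : ∀ z : ℝ × EuclideanSpace ℝ (Fin 3), z.1 < 0 → cylRadius z.2 ≠ 0 → DifferentiableAt ℝ (fun r => Φ r z.2) z.1)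
    (hΦt' : ContinuousOn (fun z : ℝ × EuclideanSpace ℝ (Fin 3) => deriv (fun r => Φ r z.2) z.1)
      {z : ℝ × EuclideanSpace ℝ (Fin 3) | z.1 < 0 ∧ cylRadius z.2 ≠ 0})
    (hsup : ∀ z : ℝ × EuclideanSpace ℝ (Fin 3), z.1 < 0 → cylRadius z.2 ≠ 0 →
      0 ≤ deriv (fun r => Φ r z.2) z.1 + fderiv ℝ (Φ z.1) z.2 (U z.1 z.2) +
          2 / cylRadius z.2 * partialDeriv (eR z.2) (Φ z.1) z.2 - (Laplacian.laplacian (Φ z.1)) z.2)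
    (hR : 0 < R)
    (hk : ∀ z : ℝ × EuclideanSpace ℝ (Fin 3), z.1 ∈ Ioo (-R ^ 2) 0 → cylRadius z.2 = 0 →
      z.2 2 ∈ Ioo (-(2 * R)) (2 * R) → z ∉ S → k ≤ Φ z.1 z.2)
    -- the normalised pair
    {Φ' : ℝ → EuclideanSpace ℝ (Fin 3) → ℝ} {U' : ℝ → EuclideanSpace ℝ (Fin 3) → EuclideanSpace ℝ (Fin 3)}
    (hΦ' : ∀ t x, t < 0 → (t, x) ∉ S → Φ' t x = Φ t x)
    (hU' : ∀ t x, t < 0 → cylRadius x ≠ 0 → U' t x = U t x)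
    -- the cover, the bumps, the piece
    {s : Finset ℕ} {z : ℕ → ℝ × EuclideanSpace ℝ (Fin 3)} {r : ℕ → ℝ} (hr : ∀ i ∈ s, 0 < r i)
    {ψ : ℕ → EuclideanSpace ℝ (Fin 3) → ℝ} (hψC : ∀ i ∈ s, ContDiff ℝ 1 (ψ i))
    (hψ01 : ∀ i ∈ s, ∀ y, 0 ≤ ψ i y ∧ ψ i y ≤ 1)
    (hψ1 : ∀ i ∈ s, ∀ y ∈ closedBall (z i).2 (2 * r i), ψ i y = 1)
    {t₁ t₂ : ℝ} (ht₁ : -R ^ 2 < t₁) (ht₂ : t₂ < 0)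
    (hcov : S ∩ (Icc t₁ t₂ ×ˢ closedBall (0 : EuclideanSpace ℝ (Fin 3)) (2 * R)) ⊆
      ⋃ i ∈ s, parabolicCylinderCentered (r i) (z i))
    {a b : ℝ} (ha : t₁ ≤ a) (hab : a ≤ b) (hb : b ≤ t₂)
    (hpart : ∀ i ∈ s, (z i).1 - 2 * r i ^ 2 ∉ Ioo a b ∧ (z i).1 + 2 * r i ^ 2 ∉ Ioo a b)
    -- the profile, the test function, the time weight, the splitting parameter
    {H : ℝ → ℝ} (hH : ContDiff ℝ 2 H) (hH' : ∀ v, deriv H v ≤ 0) (hH0 : ∀ v, 0 ≤ H v)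
    (hH2 : ∀ v, 0 ≤ deriv (deriv H) v) (hκ : ∀ v, deriv H v ^ 2 ≤ 2 * H v * deriv (deriv H) v)
    (hHk : ∀ v, k ≤ v → H v = 0)
    {Θ : EuclideanSpace ℝ (Fin 3) → ℝ} (hΘ : ContDiff ℝ 1 Θ) (hΘc : HasCompactSupport Θ)
    (hΘO : tsupport Θ ⊆ ball (0 : EuclideanSpace ℝ (Fin 3)) (2 * R))
    {η : ℝ → ℝ} (hη : ContDiff ℝ 1 η) (hη0 : ∀ s, 0 ≤ η s) {σ : ℝ} (hσ : 0 < σ)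
    -- the active set and its product cut-off (written out)
    {A : Finset ℕ} (hA : A = s.filter fun i => (z i).1 - 2 * r i ^ 2 ≤ a ∧ b ≤ (z i).1 + 2 * r i ^ 2)
    {φ : EuclideanSpace ℝ (Fin 3) → ℝ} (hφ : ∀ y, φ y = ∏ i ∈ A, (1 - ψ i y))
    -- integrability of the true integrands and of the excision-error integrands on the piece
    (iT1 : Integrable (fun w : ℝ × EuclideanSpace ℝ (Fin 3) => η w.1 * (H (Φ' w.1 w.2) * ‖gradient Θ w.2‖ ^ 2))
      (volume.restrict (Icc a b ×ˢ (univ : Set (EuclideanSpace ℝ (Fin 3))))))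
    (iT2 : Integrable (fun w : ℝ × EuclideanSpace ℝ (Fin 3) =>
        η w.1 * (H (Φ' w.1 w.2) * inner ℝ (U' w.1 w.2) (gradient (fun y => Θ y ^ 2) w.2)))
      (volume.restrict (Icc a b ×ˢ (univ : Set (EuclideanSpace ℝ (Fin 3))))))
    (iT3 : Integrable (fun w : ℝ × EuclideanSpace ℝ (Fin 3) =>
        η w.1 * (2 / cylRadius w.2 * (H (Φ' w.1 w.2) * fderiv ℝ (fun y => Θ y ^ 2) w.2 (eR w.2))))
      (volume.restrict (Icc a b ×ˢ (univ : Set (EuclideanSpace ℝ (Fin 3))))))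
    (iT4 : Integrable (fun w : ℝ × EuclideanSpace ℝ (Fin 3) => |deriv η w.1| * (H (Φ' w.1 w.2) * Θ w.2 ^ 2))
      (volume.restrict (Icc a b ×ˢ (univ : Set (EuclideanSpace ℝ (Fin 3))))))
    (iB : Integrable (fun w : ℝ × EuclideanSpace ℝ (Fin 3) =>
        η w.1 * (H (Φ' w.1 w.2) * (Θ w.2 ^ 2 * ‖gradient φ w.2‖ ^ 2)))
      (volume.restrict (Icc a b ×ˢ (univ : Set (EuclideanSpace ℝ (Fin 3))))))
    (iD : Integrable (fun w : ℝ × EuclideanSpace ℝ (Fin 3) =>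
        η w.1 * (H (Φ' w.1 w.2) * inner ℝ (U' w.1 w.2) ((Θ w.2 ^ 2) • gradient (fun y => φ y ^ 2) w.2)))
      (volume.restrict (Icc a b ×ˢ (univ : Set (EuclideanSpace ℝ (Fin 3))))))
    (iF : Integrable (fun w : ℝ × EuclideanSpace ℝ (Fin 3) =>
        η w.1 * (2 / cylRadius w.2 * (H (Φ' w.1 w.2) * (Θ w.2 ^ 2 * fderiv ℝ (fun y => φ y ^ 2) w.2 (eR w.2)))))
      (volume.restrict (Icc a b ×ˢ (univ : Set (EuclideanSpace ℝ (Fin 3)))))) :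
    (∫⁻ w in Icc a b ×ˢ (univ : Set (EuclideanSpace ℝ (Fin 3))), ENNReal.ofReal
        (1 / 2 * η w.1 * (deriv (deriv H) (Φ' w.1 w.2) * ‖gradient (Φ' w.1) w.2‖ ^ 2 * (Θ w.2 * φ w.2) ^ 2))) < ⊤ ∧
    η b * (∫ x, H (Φ' b x) * (Θ x * φ x) ^ 2) +
      (∫⁻ w in Icc a b ×ˢ (univ : Set (EuclideanSpace ℝ (Fin 3))), ENNReal.ofReal
        (1 / 2 * η w.1 * (deriv (deriv H) (Φ' w.1 w.2) * ‖gradient (Φ' w.1) w.2‖ ^ 2 * (Θ w.2 * φ w.2) ^ 2))).toReal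
    ≤ η a * (∫ x, H (Φ' a x) * (Θ x * φ x) ^ 2) +
      (1 + σ) * (4 * ∫ w in Icc a b ×ˢ (univ : Set (EuclideanSpace ℝ (Fin 3))),
        η w.1 * (H (Φ' w.1 w.2) * ‖gradient Θ w.2‖ ^ 2)) +
      (1 + σ⁻¹) * (4 * ∫ w in Icc a b ×ˢ (univ : Set (EuclideanSpace ℝ (Fin 3))),
        η w.1 * (H (Φ' w.1 w.2) * (Θ w.2 ^ 2 * ‖gradient φ w.2‖ ^ 2))) +
      (∫ w in Icc a b ×ˢ (univ : Set (EuclideanSpace ℝ (Fin 3))),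
        η w.1 * (H (Φ' w.1 w.2) * (φ w.2 ^ 2 * inner ℝ (U' w.1 w.2) (gradient (fun y => Θ y ^ 2) w.2)))) +
      (∫ w in Icc a b ×ˢ (univ : Set (EuclideanSpace ℝ (Fin 3))),
        η w.1 * (H (Φ' w.1 w.2) * |inner ℝ (U' w.1 w.2) ((Θ w.2 ^ 2) • gradient (fun y => φ y ^ 2) w.2)|)) +
      (∫ w in Icc a b ×ˢ (univ : Set (EuclideanSpace ℝ (Fin 3))),
        η w.1 * (2 / cylRadius w.2 * (H (Φ' w.1 w.2) * (φ w.2 ^ 2 * fderiv ℝ (fun y => Θ y ^ 2) w.2 (eR w.2))))) +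
      (∫ w in Icc a b ×ˢ (univ : Set (EuclideanSpace ℝ (Fin 3))),
        η w.1 * (2 / cylRadius w.2 * (H (Φ' w.1 w.2) * |Θ w.2 ^ 2 * fderiv ℝ (fun y => φ y ^ 2) w.2 (eR w.2)|))) +
      (∫ w in Icc a b ×ˢ (univ : Set (EuclideanSpace ℝ (Fin 3))), |deriv η w.1| * (H (Φ' w.1 w.2) * Θ w.2 ^ 2)) := by
  classical
  -- ### the excised test function
  have hφf : φ = fun y => ∏ i ∈ A, (1 - ψ i y) := funext hφ
  have hAs : A ⊆ s := by rw [hA]; exact Finset.filter_subset _ _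
  have hψA : ∀ i ∈ A, ContDiff ℝ 1 (ψ i) := fun i hi => hψC i (hAs hi)
  have hφC : ContDiff ℝ 1 φ := by rw [hφf]; exact contDiff_prodCut hψA
  have hφ0 : ∀ y, 0 ≤ φ y := fun y => by
    rw [hφ y]; exact prodCut_nonneg fun i hi => (hψ01 i (hAs hi) y).2
  have hφ1 : ∀ y, φ y ≤ 1 := fun y => by
    rw [hφ y]; exact prodCut_le_one (fun i hi => (hψ01 i (hAs hi) y).1) fun i hi => (hψ01 i (hAs hi) y).2
  have hΨ : ContDiff ℝ 1 (fun y => Θ y * φ y) := hΘ.mul hφC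
  have hΨc : HasCompactSupport (fun y => Θ y * φ y) := hΘc.mul_right
  have hΨO : tsupport (fun y => Θ y * φ y) ⊆ ball (0 : EuclideanSpace ℝ (Fin 3)) (2 * R) ∩
      {x | ∀ i ∈ s, ((z i).1 - 2 * r i ^ 2 ≤ a ∧ b ≤ (z i).1 + 2 * r i ^ 2) → r i < dist x (z i).2} := by
    have h := tsupport_mul_prodCut_subset (A := A) (ψ := ψ) (x := fun i => (z i).2) (r := r)
      (fun i hi y hy => hψ1 i (hAs hi) y hy) Θ
    have e : (fun y => Θ y * φ y) = fun y => Θ y * ∏ i ∈ A, (1 - ψ i y) := funext fun y => by rw [hφ y]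
    rw [e]
    refine h.trans (fun y hy => ⟨hΘO hy.1, fun i hi hact => ?_⟩)
    have hiA : i ∈ A := by rw [hA]; exact Finset.mem_filter.2 ⟨hi, hact⟩
    have := hy.2 i hiA
    linarith [hr i hi]
  -- ### the per-piece inequality for the normalised pair
  have hP := pieceEnergy_real
    (fun O hO lo hi Φ₁ U₁ hΦc₁ hΦg₁ hΦs₁ hΦt₁ hΦt'₁ hUc₁ hUs₁ hdivU₁ hU3₁ hsup₁ k₁ hk₁ H₁ hH₁ hH'₁ hH0₁ hH2₁ hκ₁ hHk₁
        Θ₁ hΘ₁ hΘc₁ hΘO₁ η₁ hη₁ hη0₁ t₁' t' h1 h1t ht =>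
      energyClass_ineq_acrossAxis_v3_real hO hΦc₁ hΦg₁ hΦs₁ hΦt₁ hΦt'₁ hUc₁ hUs₁ hdivU₁ hU3₁ hsup₁ hk₁ hH₁ hH'₁ hH0₁
        hH2₁ hκ₁ hHk₁ hΘ₁ hΘc₁ hΘO₁ hη₁ hη0₁ h1 h1t ht)
    hUc hUs hdivU hU3 hSc hSax hΦc hΦs hΦg hΦt hΦt' hsup hR hk hΦ' hU' ht₁ ht₂ hcov ha hab hb hpart
    hH hH' hH0 hH2 hκ hHk hΨ hΨc hΨO hη hη0
  obtain ⟨hfin, hineq⟩ := hP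
  refine ⟨hfin, ?_⟩
  -- ### expansion
  set μ : Measure (ℝ × EuclideanSpace ℝ (Fin 3)) :=
    volume.restrict (Icc a b ×ˢ (univ : Set (EuclideanSpace ℝ (Fin 3)))) with hμ
  have iA : Integrable (fun w : ℝ × EuclideanSpace ℝ (Fin 3) =>
      η w.1 * (H (Φ' w.1 w.2) * (φ w.2 ^ 2 * ‖gradient Θ w.2‖ ^ 2))) μ :=
    integrable_weight_mul hφC.continuous hφ0 hφ1 iT1
  have iC : Integrable (fun w : ℝ × EuclideanSpace ℝ (Fin 3) =>
      η w.1 * (H (Φ' w.1 w.2) * (φ w.2 ^ 2 * inner ℝ (U' w.1 w.2) (gradient (fun y => Θ y ^ 2) w.2)))) μ :=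
    integrable_weight_mul hφC.continuous hφ0 hφ1 iT2
  have iE : Integrable (fun w : ℝ × EuclideanSpace ℝ (Fin 3) =>
      η w.1 * (2 / cylRadius w.2 * (H (Φ' w.1 w.2) * (φ w.2 ^ 2 * fderiv ℝ (fun y => Θ y ^ 2) w.2 (eR w.2))))) μ := by
    have e : (fun w : ℝ × EuclideanSpace ℝ (Fin 3) =>
        η w.1 * (2 / cylRadius w.2 * (H (Φ' w.1 w.2) * (φ w.2 ^ 2 * fderiv ℝ (fun y => Θ y ^ 2) w.2 (eR w.2))))) =
        fun w => φ w.2 ^ 2 * (η w.1 * (2 / cylRadius w.2 * (H (Φ' w.1 w.2) * fderiv ℝ (fun y => Θ y ^ 2) w.2 (eR w.2)))) := by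
      funext w; ring
    rw [e]
    refine iT3.bdd_mul (c := 1) (((hφC.continuous.comp continuous_snd).pow 2).aestronglyMeasurable) ?_
    refine Eventually.of_forall fun w => ?_
    rw [Real.norm_eq_abs, abs_of_nonneg (sq_nonneg _)]
    nlinarith [hφ0 w.2, hφ1 w.2]
  have hexp := pieceEnergy_expanded (μ := μ) hH0 hΘ hφC hη0 hσ iA iB iC iD iE iF hineq
  -- ### the two monotone comparisons
  have hT1 : (∫ w, η w.1 * (H (Φ' w.1 w.2) * (φ w.2 ^ 2 * ‖gradient Θ w.2‖ ^ 2)) ∂μ) ≤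
      ∫ w, η w.1 * (H (Φ' w.1 w.2) * ‖gradient Θ w.2‖ ^ 2) ∂μ := by
    have e : (fun w : ℝ × EuclideanSpace ℝ (Fin 3) => η w.1 * (H (Φ' w.1 w.2) * (φ w.2 ^ 2 * ‖gradient Θ w.2‖ ^ 2))) =
        fun w => φ w.2 ^ 2 * (η w.1 * (H (Φ' w.1 w.2) * ‖gradient Θ w.2‖ ^ 2)) := by
      funext w; ring
    rw [e]
    exact integral_weight_le (φ := fun w : ℝ × EuclideanSpace ℝ (Fin 3) => φ w.2) iT1
      (fun w => mul_nonneg (hη0 _) (mul_nonneg (hH0 _) (sq_nonneg _))) (fun w => hφ0 w.2) fun w => hφ1 w.2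
  have hT4 : (∫ w, |deriv η w.1| * (H (Φ' w.1 w.2) * (Θ w.2 * φ w.2) ^ 2) ∂μ) ≤
      ∫ w, |deriv η w.1| * (H (Φ' w.1 w.2) * Θ w.2 ^ 2) ∂μ := by
    have e : (fun w : ℝ × EuclideanSpace ℝ (Fin 3) => |deriv η w.1| * (H (Φ' w.1 w.2) * (Θ w.2 * φ w.2) ^ 2)) =
        fun w => φ w.2 ^ 2 * (|deriv η w.1| * (H (Φ' w.1 w.2) * Θ w.2 ^ 2)) := by
      funext w; ring
    rw [e]
    exact integral_weight_le (φ := fun w : ℝ × EuclideanSpace ℝ (Fin 3) => φ w.2) iT4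
      (fun w => mul_nonneg (abs_nonneg _) (mul_nonneg (hH0 _) (sq_nonneg _))) (fun w => hφ0 w.2) fun w => hφ1 w.2
  have h1σ : 0 ≤ 1 + σ := by linarith
  nlinarith [hexp, hT1, hT4, mul_le_mul_of_nonneg_left (mul_le_mul_of_nonneg_left hT1 (by norm_num : (0:ℝ) ≤ 4)) h1σ]

end Summit.NavierStokesRegularity.NavierStokesRegularity.Theorems.AxisymmetricKatoGlobal.EulerScaling

end
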